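import Summits.Langlands.Langlands.Theses.QuarterDeficit1951
import Literature.NumberTheory.GaloisRepresentations.GaloisRepUnramifiedProofs
import Literature.NumberTheory.GaloisRepresentations.TateUnramifiedLiftingHolds
import Literature.NumberTheory.GaloisRepresentations.DirichletCharacterOfGaloisCharacter
import Literature.FieldTheory.AlgClosed.PadicAlgClEquivComplex
import Literature.NumberTheory.Automorphic.BCDTTheoremBWildAtThreeDet
import Literature.NumberTheory.GaloisRepresentations.IntegralGaloisActionProofs

/-!
# Route `QuarterDeficit1951` (Langlands) — crux `IcosahedralSupply`: stub `stub_dmGaloisDatum`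

The five roots `θ i ∈ ℤ̄ ⊆ ℚ̄` of the Doud–Moore quintic
`f = x⁵ − x⁴ − 780x³ + 9911x² − 24208x + 15952`, the permutation representation
`e₀ : Γ_ℚ → S₅` on them, openness of its kernel, and triviality of complex conjugations on
the roots.  Everything is proved from scratch:

* `f` has five real roots, one in each of the intervals `(-33, -32)`, `(1, 3/2)`, `(3/2, 2)`,
  `(13, 14)`, `(17, 18)` (intermediate value theorem), hence — a quintic having at most five
  complex roots — every complex root of `f` is real and `f` is separable;
* over `ℚ̄` the separable quintic `f` has exactly five roots; they are algebraic integers (`f` is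
  monic with integer coefficients), `Γ_ℚ` permutes them, and the resulting homomorphism
  `e₀ : Γ_ℚ → S₅` has kernel `⋂ᵢ Stab(θ i)`, which is open for the Krull topology;
* a complex conjugation `c` (`ι (c • x) = conj (ι x)` for some `ι : ℚ̄ →+* ℂ`) fixes each
  `θ i` because `ι (θ i)` is a complex root of `f`, hence real.

Reference: D. Doud, M. W. Moore, *Even icosahedral Galois representations of prime conductor*,
J. Number Theory 118 (2006), §4 (Table, `p = 1951`). [`DoudMoore2006`]
-/

set_option linter.dupNamespace false

noncomputable section

open scoped NumberField MatrixGroups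
open Field IsDedekindDomain Polynomial
open Literature.NumberTheory.GaloisRepresentations Literature.NumberTheory.PAdicHodge

namespace Summit.Langlands.Langlands.Theorems.QuarterDeficit1951

/-! ## The quintic: evaluation, degree, behaviour under ring homomorphisms -/

/-- Evaluation of the Doud–Moore quintic. [folklore] -/
private theorem eval_dmF {R : Type*} [CommRing R] (x : R) :
    eval x (X ^ 5 - X ^ 4 - 780 * X ^ 3 + 9911 * X ^ 2 - 24208 * X + 15952 : R[X]) =
      x ^ 5 - x ^ 4 - 780 * x ^ 3 + 9911 * x ^ 2 - 24208 * x + 15952 := by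
  simp only [eval_add, eval_sub, eval_mul, eval_pow, eval_X, eval_ofNat]

/-- The Doud–Moore quintic has degree `5`. [folklore] -/
private theorem natDegree_dmF {R : Type*} [CommRing R] [Nontrivial R] :
    (X ^ 5 - X ^ 4 - 780 * X ^ 3 + 9911 * X ^ 2 - 24208 * X + 15952 : R[X]).natDegree = 5 := by
  compute_degree!

/-- The Doud–Moore quintic is monic. [folklore] -/
private theorem monic_dmF {R : Type*} [CommRing R] [Nontrivial R] :
    (X ^ 5 - X ^ 4 - 780 * X ^ 3 + 9911 * X ^ 2 - 24208 * X + 15952 : R[X]).Monic := by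
  monicity!

/-- The Doud–Moore quintic is non-zero. [folklore] -/
private theorem dmF_ne_zero {R : Type*} [CommRing R] [Nontrivial R] :
    (X ^ 5 - X ^ 4 - 780 * X ^ 3 + 9911 * X ^ 2 - 24208 * X + 15952 : R[X]) ≠ 0 :=
  (monic_dmF (R := R)).ne_zero

/-- The Doud–Moore quintic is defined over the prime ring: it is preserved by `Polynomial.map`.
[folklore] -/
private theorem map_dmF {R S : Type*} [CommRing R] [CommRing S] (g : R →+* S) :
    (X ^ 5 - X ^ 4 - 780 * X ^ 3 + 9911 * X ^ 2 - 24208 * X + 15952 : R[X]).map g =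
      X ^ 5 - X ^ 4 - 780 * X ^ 3 + 9911 * X ^ 2 - 24208 * X + 15952 := by
  simp only [Polynomial.map_add, Polynomial.map_sub, Polynomial.map_mul, Polynomial.map_pow,
    map_X, Polynomial.map_ofNat]

/-- Membership in the root multiset of the Doud–Moore quintic over a domain. [folklore] -/
private theorem mem_roots_dmF {R : Type*} [CommRing R] [IsDomain R] (x : R) :
    x ∈ (X ^ 5 - X ^ 4 - 780 * X ^ 3 + 9911 * X ^ 2 - 24208 * X + 15952 : R[X]).roots ↔
      x ^ 5 - x ^ 4 - 780 * x ^ 3 + 9911 * x ^ 2 - 24208 * x + 15952 = 0 := by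
  rw [mem_roots dmF_ne_zero, IsRoot.def, eval_dmF]

/-- Ring homomorphisms commute with the evaluation of the Doud–Moore quintic. [folklore] -/
private theorem map_dmP {F A B : Type*} [Ring A] [Ring B] [FunLike F A B] [RingHomClass F A B]
    (g : F) (x : A) :
    g (x ^ 5 - x ^ 4 - 780 * x ^ 3 + 9911 * x ^ 2 - 24208 * x + 15952) =
      g x ^ 5 - g x ^ 4 - 780 * g x ^ 3 + 9911 * g x ^ 2 - 24208 * g x + 15952 := by
  simp only [map_sub, map_add, map_mul, map_pow, map_ofNat]

/-! ## Five real roots; all complex roots are real; separability -/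

/-- Intermediate value theorem on an interval with a sign change (either direction).
[folklore] -/
private theorem exists_Ioo_eq_zero {f : ℝ → ℝ} (hf : Continuous f) {a b : ℝ} (hab : a ≤ b)
    (h : f a < 0 ∧ 0 < f b ∨ f b < 0 ∧ 0 < f a) : ∃ r ∈ Set.Ioo a b, f r = 0 := by
  rcases h with ⟨ha, hb⟩ | ⟨hb, ha⟩
  · obtain ⟨r, hr, hr0⟩ := intermediate_value_Ioo hab hf.continuousOn ⟨ha, hb⟩
    exact ⟨r, hr, hr0⟩
  · obtain ⟨r, hr, hr0⟩ := intermediate_value_Ioo' hab hf.continuousOn ⟨hb, ha⟩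
    exact ⟨r, hr, hr0⟩

/-- The Doud–Moore quintic has five distinct real roots (sign changes on `(-33, -32)`,
`(1, 3/2)`, `(3/2, 2)`, `(13, 14)`, `(17, 18)`). [cite: DoudMoore2006, §4 (Table, p = 1951)] -/
private theorem exists_five_real_roots :
    ∃ r : Fin 5 → ℝ, Function.Injective r ∧
      ∀ k, r k ^ 5 - r k ^ 4 - 780 * r k ^ 3 + 9911 * r k ^ 2 - 24208 * r k + 15952 = 0 := by
  have hfc : Continuous fun x : ℝ =>
      x ^ 5 - x ^ 4 - 780 * x ^ 3 + 9911 * x ^ 2 - 24208 * x + 15952 := by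
    fun_prop
  obtain ⟨r₀, h₀, hr₀⟩ := exists_Ioo_eq_zero hfc (show (-33 : ℝ) ≤ -32 by norm_num)
    (Or.inl ⟨by norm_num, by norm_num⟩)
  obtain ⟨r₁, h₁, hr₁⟩ := exists_Ioo_eq_zero hfc (show (1 : ℝ) ≤ 3 / 2 by norm_num)
    (Or.inr ⟨by norm_num, by norm_num⟩)
  obtain ⟨r₂, h₂, hr₂⟩ := exists_Ioo_eq_zero hfc (show (3 / 2 : ℝ) ≤ 2 by norm_num)
    (Or.inl ⟨by norm_num, by norm_num⟩)
  obtain ⟨r₃, h₃, hr₃⟩ := exists_Ioo_eq_zero hfc (show (13 : ℝ) ≤ 14 by norm_num)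
    (Or.inr ⟨by norm_num, by norm_num⟩)
  obtain ⟨r₄, h₄, hr₄⟩ := exists_Ioo_eq_zero hfc (show (17 : ℝ) ≤ 18 by norm_num)
    (Or.inl ⟨by norm_num, by norm_num⟩)
  simp only [Set.mem_Ioo] at h₀ h₁ h₂ h₃ h₄
  refine ⟨![r₀, r₁, r₂, r₃, r₄], ?_, ?_⟩
  · intro i j hij
    fin_cases i <;> fin_cases j <;> first | rfl | (exfalso; simp at hij; linarith)
  · intro k
    fin_cases k
    exacts [hr₀, hr₁, hr₂, hr₃, hr₄]

/-- A non-zero polynomial of degree `≤ #S` vanishing on a finite set `S` has root set exactly `S`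
and no repeated roots. [folklore] -/
private theorem roots_eq_of_card {R : Type*} [CommRing R] [IsDomain R] [DecidableEq R]
    {p : R[X]} (hp : p ≠ 0) (S : Finset R) (hdeg : p.natDegree ≤ S.card)
    (hS : ∀ x ∈ S, p.IsRoot x) : p.roots.toFinset = S ∧ p.roots.Nodup := by
  have hsub : S ⊆ p.roots.toFinset := fun x hx =>
    Multiset.mem_toFinset.mpr ((mem_roots hp).mpr (hS x hx))
  have h1 : p.roots.toFinset.card ≤ p.roots.card := Multiset.toFinset_card_le _
  have h2 : p.roots.card ≤ S.card := (card_roots' p).trans hdeg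
  have heq : S = p.roots.toFinset := Finset.eq_of_subset_of_card_le hsub (h1.trans h2)
  refine ⟨heq.symm, ?_⟩
  rw [← Multiset.toFinset_card_eq_card_iff_nodup]
  exact le_antisymm h1 (h2.trans_eq (congrArg Finset.card heq))

/-- **All complex roots of the Doud–Moore quintic are real, and it is separable**: its five
distinct real roots exhaust the at most five complex roots. [folklore] -/
private theorem dmF_complex :
    (X ^ 5 - X ^ 4 - 780 * X ^ 3 + 9911 * X ^ 2 - 24208 * X + 15952 : ℚ[X]).Separable ∧
      ∀ z : ℂ, z ^ 5 - z ^ 4 - 780 * z ^ 3 + 9911 * z ^ 2 - 24208 * z + 15952 = 0 →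
        starRingEnd ℂ z = z := by
  classical
  obtain ⟨r, hr, hroot⟩ := exists_five_real_roots
  have hinjC : Function.Injective fun k => (r k : ℂ) := fun a b h =>
    hr (Complex.ofReal_injective h)
  obtain ⟨hTS, hnodup⟩ := roots_eq_of_card (dmF_ne_zero (R := ℂ))
    (Finset.univ.image fun k => (r k : ℂ))
    (by rw [Finset.card_image_of_injective _ hinjC, Finset.card_univ, Fintype.card_fin,
      natDegree_dmF])
    (by
      intro z hz
      obtain ⟨k, -, rfl⟩ := Finset.mem_image.mp hz
      rw [IsRoot.def, eval_dmF]
      exact_mod_cast hroot k)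
  refine ⟨?_, fun z hz => ?_⟩
  · rw [← separable_map (algebraMap ℚ ℂ), map_dmF]
    exact (nodup_roots_iff_of_splits dmF_ne_zero (IsAlgClosed.splits _)).mp hnodup
  · have hzS : z ∈ Finset.univ.image fun k => (r k : ℂ) := by
      rw [← hTS, Multiset.mem_toFinset, mem_roots_dmF]
      exact hz
    obtain ⟨k, -, rfl⟩ := Finset.mem_image.mp hzS
    exact Complex.conj_ofReal _

/-! ## The five roots in `ℚ̄` -/

/-- Over `ℚ̄` the (separable) Doud–Moore quintic has exactly five roots: an injective
enumeration `θ : Fin 5 → ℚ̄` of its root set. [folklore] -/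
private theorem exists_five_roots_algClosure :
    ∃ θ : Fin 5 → AlgebraicClosure ℚ, Function.Injective θ ∧
      (∀ i, θ i ^ 5 - θ i ^ 4 - 780 * θ i ^ 3 + 9911 * θ i ^ 2 - 24208 * θ i + 15952 = 0) ∧
      ∀ x : AlgebraicClosure ℚ,
        x ^ 5 - x ^ 4 - 780 * x ^ 3 + 9911 * x ^ 2 - 24208 * x + 15952 = 0 → ∃ i, x = θ i := by
  classical
  have hsep := (dmF_complex.1).map (f := algebraMap ℚ (AlgebraicClosure ℚ))
  rw [map_dmF] at hsep
  have hcard := Multiset.toFinset_card_of_nodup (nodup_roots hsep)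
  rw [← (IsAlgClosed.splits _).natDegree_eq_card_roots, natDegree_dmF] at hcard
  set e := (Finset.equivFinOfCardEq hcard).symm with he
  refine ⟨fun i => (e i : AlgebraicClosure ℚ), Subtype.val_injective.comp e.injective,
    fun i => ?_, fun x hx => ?_⟩
  · have h := (e i).2
    rw [Multiset.mem_toFinset, mem_roots_dmF] at h
    exact h
  · exact ⟨e.symm ⟨x, by rw [Multiset.mem_toFinset, mem_roots_dmF]; exact hx⟩,
      by simp only [Equiv.apply_symm_apply]⟩

/-! ## The stub -/

/-- **Stub (roots and the permutation representation).** The Doud–Moore quintic has five distinct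
roots `θ i` in `ℤ̄ ⊆ ℚ̄`, every root of it in `ℚ̄` is one of them, `Γ_ℚ` permutes them through a
homomorphism `e₀ : Γ_ℚ → S₅` with open kernel, and every complex conjugation fixes them (the five
roots are real). [cite: DoudMoore2006, §4 (Table, p = 1951)] -/
theorem stub_dmGaloisDatum :
    ∃ (θ : Fin 5 → absIntegers (𝓞 ℚ) ℚ) (e₀ : absoluteGaloisGroup ℚ →* Equiv.Perm (Fin 5)),
      (∀ i, θ i ^ 5 - θ i ^ 4 - 780 * θ i ^ 3 + 9911 * θ i ^ 2 - 24208 * θ i + 15952 = 0) ∧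
      Function.Injective θ ∧
      (∀ x : AlgebraicClosure ℚ, x ^ 5 - x ^ 4 - 780 * x ^ 3 + 9911 * x ^ 2 - 24208 * x + 15952 = 0 →
        ∃ i, x = θ i) ∧
      (∀ (σ : absoluteGaloisGroup ℚ) (i : Fin 5), σ • θ i = θ (e₀ σ i)) ∧
      IsOpen ((e₀.ker : Subgroup (absoluteGaloisGroup ℚ)) : Set (absoluteGaloisGroup ℚ)) ∧
      (∀ (φ : ℚ →+* ℝ) (c : absoluteGaloisGroup ℚ), IsComplexConjugation φ c →
        ∀ i, c • θ i = θ i) := by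
  classical
  obtain ⟨θ', hinj', hroot', hall'⟩ := exists_five_roots_algClosure
  -- the roots are algebraic integers
  have hint : ∀ i, θ' i ∈ absIntegers (𝓞 ℚ) ℚ := fun i => by
    rw [mem_integralClosure_iff]
    refine ⟨X ^ 5 - X ^ 4 - 780 * X ^ 3 + 9911 * X ^ 2 - 24208 * X + 15952, monic_dmF, ?_⟩
    rw [eval₂_eq_eval_map, map_dmF, eval_dmF]
    exact hroot' i
  let θ : Fin 5 → absIntegers (𝓞 ℚ) ℚ := fun i => ⟨θ' i, hint i⟩
  have hθ : ∀ i, ((θ i : absIntegers (𝓞 ℚ) ℚ) : AlgebraicClosure ℚ) = θ' i := fun i => rfl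
  have hinj : Function.Injective θ := fun i j h => hinj' (congrArg Subtype.val h)
  have hroot : ∀ i,
      θ i ^ 5 - θ i ^ 4 - 780 * θ i ^ 3 + 9911 * θ i ^ 2 - 24208 * θ i + 15952 = 0 := by
    intro i
    apply Subtype.val_injective
    have h := map_dmP (absIntegers (𝓞 ℚ) ℚ).val (θ i)
    simp only [Subalgebra.val_apply] at h
    rw [h, ZeroMemClass.coe_zero, hθ]
    exact hroot' i
  -- `Γ_ℚ` permutes the roots
  have hsmul : ∀ (σ : absoluteGaloisGroup ℚ) (i : Fin 5), ∃ j, σ • θ i = θ j := by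
    intro σ i
    have h := map_dmP
      (MulSemiringAction.toRingHom (absoluteGaloisGroup ℚ) (AlgebraicClosure ℚ) σ) (θ' i)
    simp only [MulSemiringAction.toRingHom_apply] at h
    rw [hroot' i, smul_zero] at h
    obtain ⟨j, hj⟩ := hall' _ h.symm
    exact ⟨j, Subtype.ext (by rw [integralClosure.coe_smul, hθ, hj, hθ])⟩
  choose g hg using hsmul
  have hg1 : ∀ i, g 1 i = i := fun i => hinj (by rw [← hg 1 i, one_smul])
  have hgmul : ∀ (σ τ : absoluteGaloisGroup ℚ) (i : Fin 5), g (σ * τ) i = g σ (g τ i) :=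
    fun σ τ i => hinj (by rw [← hg (σ * τ) i, mul_smul, hg τ i, hg σ (g τ i)])
  let e₀ : absoluteGaloisGroup ℚ →* Equiv.Perm (Fin 5) :=
    MonoidHom.mk'
      (fun σ => ⟨g σ, g σ⁻¹, fun i => by rw [← hgmul, inv_mul_cancel, hg1],
        fun i => by rw [← hgmul, mul_inv_cancel, hg1]⟩)
      (fun σ τ => Equiv.ext fun i => hgmul σ τ i)
  have he₀ : ∀ (σ : absoluteGaloisGroup ℚ) (i : Fin 5), e₀ σ i = g σ i := fun σ i => rfl
  refine ⟨θ, e₀, hroot, hinj, fun x hx => ?_, fun σ i => by rw [he₀]; exact hg σ i, ?_, ?_⟩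
  · -- every root is one of the `θ i`
    obtain ⟨i, hi⟩ := hall' x hx
    exact ⟨i, by rw [hθ]; exact hi⟩
  · -- the kernel is the (finite) intersection of the open stabilisers
    have hker : ((e₀.ker : Subgroup (absoluteGaloisGroup ℚ)) : Set (absoluteGaloisGroup ℚ)) =
        ⋂ i, (MulAction.stabilizer (absoluteGaloisGroup ℚ) (θ i) :
          Set (absoluteGaloisGroup ℚ)) := by
      ext σ
      simp only [SetLike.mem_coe, MonoidHom.mem_ker, Set.mem_iInter,
        MulAction.mem_stabilizer_iff]
      constructor
      · intro h i
        rw [hg σ i, ← he₀, h, Equiv.Perm.coe_one, id_eq]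
      · intro h
        exact Equiv.ext fun i => by
          rw [he₀, Equiv.Perm.coe_one, id_eq]
          exact hinj ((hg σ i).symm.trans (h i))
    rw [hker]
    exact isOpen_iInter_of_finite fun i => absIntegers.isOpen_stabilizer (𝓞 ℚ) (θ i)
  · -- complex conjugations fix the (real) roots
    intro φ c hc i
    obtain ⟨ι, -, hι⟩ := isComplexConjugation_iff.mp hc
    apply Subtype.ext
    rw [integralClosure.coe_smul, hθ]
    apply ι.injective
    rw [hι]
    apply dmF_complex.2
    rw [← map_dmP ι (θ' i), hroot' i, map_zero]

end Summit.Langlands.Langlands.Theorems.QuarterDeficit1951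

end
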